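import Literature.Analysis.ODE.BarrierBasis
import HarnessLib

/-!
# Upper bounds for the monotone barrier basis of `y″ = q y` (`0 ≤ q ≤ K²`)

Topic `Literature/Analysis/ODE` (namespace `Literature.Analysis.ODE`), the mirror image of
`BarrierBasis.lean`. There the end-normalised real solutions `g` (`g(α) = 1, g′(α) = 0`) and `d`
(`d(β) = 1, d′(β) = 0`) of `y″ = q(x) y` on a forbidden interval `[α, β]` (`q ≥ 0`) were bounded
from BELOW by the constant-coefficient solutions when `q ≥ k²`. Here are the matching bounds
from ABOVE, in the same pointwise `HasDerivAt`-on-`[α, β]` form (no global solution, no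
continuity of `q` is assumed):

* `le_of_majorant_sol` — **Sturm comparison under a positive majorant**: if `u″ = q u` with
  `u ≥ 0`, and `C > 0` solves `C″ = c C` with `q ≤ c` (both coefficients may vary), `C′ ≥ 0`,
  `u(s₀) ≤ C(s₀)` and the Wronskian `u′ C − u C′` is `≤ 0` at `s₀`, then `u ≤ C` and `u′ ≤ C′` on
  `[s₀, T]` (the Wronskian has derivative `(q − c) u C ≤ 0`, so `u / C` is non-increasing);
* `pos_of_left_data_of_nonneg_coeff` — the solution with data `(1, 0)` at the left end of an
  interval where `q ≥ 0` is positive there (without a first-zero argument: `(g g′)′ = g′² + q g²`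
  is `≥ 0`, so `g g′ ≥ 0`, so `g²` is non-decreasing, `g² ≥ 1`, and `g` cannot vanish);
* `barrierBasis_upper` — for `0 ≤ q ≤ K²` (`K ≥ 0`) and `x ∈ [α, β]`:
  `g(x) ≤ cosh K(x − α)`, `g′(x) ≤ K sinh K(x − α)`, and (using only `q ≥ 0`) `g′` is
  non-decreasing, so `g′(x) ≤ g′(β)` and `g(x) ≤ 1 + g′(β)(x − α)`;
* `barrierBasis_upper_right` — the mirror statement for `d`, obtained from the left version
  applied to the reflected solution `x ↦ d(α + β − x)`:
  `d(x) ≤ cosh K(β − x)`, `−d′(x) ≤ K sinh K(β − x)`, `d(x) ≤ 1 + (−d′(α))(β − x)`,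
  `−d′(x) ≤ −d′(α)`.

With the barrier length `L = β − α` and `w₀ = g′(β) = −d′(α)` these give `g(β) ≤ 1 + w₀ L`,
`d(α) ≤ 1 + w₀ L`, `w₀ ≤ K sinh(K L)`: the sizes of the barrier basis enter the cone Green-kernel
bounds polynomially.

## References

* P. Hartman, *Ordinary Differential Equations*, Classics in Applied Mathematics 38 (SIAM 2002),
  Ch. XI §3 (Sturm's comparison theorems, Thm. 3.2 in the logarithmic-derivative form (3.4);
  Ex. 3.1(a) for the Wronskian device) and §6 (disconjugacy; Cor. 6.4 and its proof: positive
  solutions are convex when `q ≥ 0`). Key `Hartman2002`.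
* F. W. J. Olver, *Asymptotics and Special Functions* (Academic Press 1974), Ch. 6 §§1–2
  (exponential-type solutions in intervals free of turning points). Key `Olver1974`.
-/

noncomputable section

open Set

namespace Literature.Analysis.ODE

/-! ## Sturm comparison under a positive majorant -/

/-- **Sturm comparison under a positive majorant solution.** On `[s₀, T]` let `u″ = q u` with
`u ≥ 0`, and let `C > 0` satisfy `C″ = c C` with `q ≤ c` and `C′ ≥ 0`. If `u s₀ ≤ C s₀` and the
Wronskian `u′ C − u C′` is nonpositive at `s₀`, then `u ≤ C` and `u′ ≤ C′` on `[s₀, T]`: the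
Wronskian has derivative `(q − c) u C ≤ 0`, hence stays `≤ 0`, so `u / C` is non-increasing and
`u ≤ C`; finally `u′ C ≤ u C′ ≤ C C′` (Hartman Ch. XI: the logarithmic-derivative form of
Sturm's second comparison theorem with no zeros, proved by the Wronskian device of Ex. 3.1(a)).
[cite: Hartman2002, Ch. XI Thm. 3.2 and Ex. 3.1(a)] -/
theorem le_of_majorant_sol {u u' C C' q c : ℝ → ℝ} {s₀ T : ℝ}
    (hu : ∀ s ∈ Icc s₀ T, HasDerivAt u (u' s) s ∧ HasDerivAt u' (q s * u s) s)
    (hC : ∀ s ∈ Icc s₀ T, HasDerivAt C (C' s) s ∧ HasDerivAt C' (c s * C s) s)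
    (hqc : ∀ s ∈ Icc s₀ T, q s ≤ c s) (hu0 : ∀ s ∈ Icc s₀ T, 0 ≤ u s)
    (hC0 : ∀ s ∈ Icc s₀ T, 0 < C s) (hC'0 : ∀ s ∈ Icc s₀ T, 0 ≤ C' s)
    (h0 : u s₀ ≤ C s₀) (h1 : u' s₀ * C s₀ ≤ u s₀ * C' s₀) :
    ∀ s ∈ Icc s₀ T, u s ≤ C s ∧ u' s ≤ C' s := by
  -- the Wronskian `Φ = u′ C − u C′` is non-increasing
  have hΦ : ∀ s ∈ Icc s₀ T, HasDerivAt (fun s => u' s * C s - u s * C' s)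
      ((q s - c s) * u s * C s) s := fun s hs =>
    (((hu s hs).2.mul (hC s hs).1).sub ((hu s hs).1.mul (hC s hs).2)).congr_deriv (by ring)
  have hΦanti : AntitoneOn (fun s => u' s * C s - u s * C' s) (Icc s₀ T) :=
    antitoneOn_of_deriv_nonpos (convex_Icc s₀ T)
      (fun s hs => (hΦ s hs).continuousAt.continuousWithinAt)
      (fun s hs => (hΦ s (interior_subset hs)).differentiableAt.differentiableWithinAt)
      fun s hs => by
        have hs' : s ∈ Icc s₀ T := interior_subset hs
        rw [(hΦ s hs').deriv]
        have h : 0 ≤ (c s - q s) * u s * C s :=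
          mul_nonneg (mul_nonneg (sub_nonneg.2 (hqc s hs')) (hu0 s hs')) (hC0 s hs').le
        linarith
  have hΦ0 : ∀ s ∈ Icc s₀ T, u' s * C s ≤ u s * C' s := fun s hs => by
    have h : u' s * C s - u s * C' s ≤ u' s₀ * C s₀ - u s₀ * C' s₀ :=
      hΦanti (left_mem_Icc.2 (hs.1.trans hs.2)) hs hs.1
    linarith
  -- hence `u / C` is non-increasing
  have hR : ∀ s ∈ Icc s₀ T, HasDerivAt (fun s => u s / C s)
      ((u' s * C s - u s * C' s) / C s ^ 2) s := fun s hs =>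
    (hu s hs).1.div (hC s hs).1 (hC0 s hs).ne'
  have hRanti : AntitoneOn (fun s => u s / C s) (Icc s₀ T) :=
    antitoneOn_of_deriv_nonpos (convex_Icc s₀ T)
      (fun s hs => (hR s hs).continuousAt.continuousWithinAt)
      (fun s hs => (hR s (interior_subset hs)).differentiableAt.differentiableWithinAt)
      fun s hs => by
        have hs' : s ∈ Icc s₀ T := interior_subset hs
        rw [(hR s hs').deriv]
        exact div_nonpos_of_nonpos_of_nonneg (sub_nonpos.2 (hΦ0 s hs')) (sq_nonneg _)
  intro s hs
  have hs₀ : s₀ ∈ Icc s₀ T := left_mem_Icc.2 (hs.1.trans hs.2)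
  have hCs : 0 < C s := hC0 s hs
  have hle : u s ≤ C s := by
    have h : u s / C s ≤ u s₀ / C s₀ := hRanti hs₀ hs hs.1
    have h2 := h.trans ((div_le_one (hC0 s₀ hs₀)).2 h0)
    rwa [div_le_one hCs] at h2
  refine ⟨hle, ?_⟩
  -- `u′ C ≤ u C′ ≤ C C′ = C′ C`
  have h2 : u' s * C s ≤ C' s * C s :=
    calc u' s * C s ≤ u s * C' s := hΦ0 s hs
      _ ≤ C s * C' s := mul_le_mul_of_nonneg_right hle (hC'0 s hs)
      _ = C' s * C s := mul_comm _ _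
  exact le_of_mul_le_mul_right h2 hCs

/-! ## Positivity of the left-normalised solution -/

/-- **The left-normalised solution is positive** (local form). If `g″ = q g` on `[α, β]` in the
pointwise `HasDerivAt` sense, `q ≥ 0` there, `g(α) = 1` and `g′(α) = 0`, then `g > 0` on `[α, β]`.
Proof without a first-zero argument: `(g g′)′ = g′² + q g² ≥ 0` and `(g g′)(α) = 0`, so
`g g′ ≥ 0`; hence `g²` is non-decreasing, `g² ≥ 1`, so the continuous `g` has no zero on `[α, β]`
and keeps the sign of `g(α) = 1` (intermediate value theorem).
[cite: Hartman2002, Ch. XI Cor. 6.4 (proof)] -/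
theorem pos_of_left_data_of_nonneg_coeff {q g g' : ℝ → ℝ} {α β : ℝ}
    (hg : ∀ x ∈ Icc α β, HasDerivAt g (g' x) x ∧ HasDerivAt g' (q x * g x) x)
    (hgα : g α = 1) (hg'α : g' α = 0) (hq0 : ∀ x ∈ Icc α β, 0 ≤ q x) :
    ∀ x ∈ Icc α β, 0 < g x := by
  -- `h = g g′` has `h′ = g′² + q g² ≥ 0` and `h(α) = 0`, so `g g′ ≥ 0`
  have hh : ∀ x ∈ Icc α β,
      HasDerivAt (fun x => g x * g' x) (g' x * g' x + g x * (q x * g x)) x := fun x hx =>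
    (hg x hx).1.mul (hg x hx).2
  have hmono : MonotoneOn (fun x => g x * g' x) (Icc α β) :=
    monotoneOn_of_deriv_nonneg (convex_Icc α β)
      (fun x hx => (hh x hx).continuousAt.continuousWithinAt)
      (fun x hx => (hh x (interior_subset hx)).differentiableAt.differentiableWithinAt)
      fun x hx => by
        have hx' : x ∈ Icc α β := interior_subset hx
        rw [(hh x hx').deriv]
        have h1 : 0 ≤ q x * (g x * g x) := mul_nonneg (hq0 x hx') (mul_self_nonneg _)
        have h2 := mul_self_nonneg (g' x)
        linarith
  have hgg' : ∀ x ∈ Icc α β, 0 ≤ g x * g' x := fun x hx => by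
    have h : g α * g' α ≤ g x * g' x := hmono (left_mem_Icc.2 (hx.1.trans hx.2)) hx hx.1
    rwa [hg'α, mul_zero] at h
  -- hence `g²` is non-decreasing and `g² ≥ 1`
  have hsq : ∀ x ∈ Icc α β, HasDerivAt (fun x => g x * g x) (g' x * g x + g x * g' x) x :=
    fun x hx => (hg x hx).1.mul (hg x hx).1
  have hmono2 : MonotoneOn (fun x => g x * g x) (Icc α β) :=
    monotoneOn_of_deriv_nonneg (convex_Icc α β)
      (fun x hx => (hsq x hx).continuousAt.continuousWithinAt)
      (fun x hx => (hsq x (interior_subset hx)).differentiableAt.differentiableWithinAt)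
      fun x hx => by
        have hx' : x ∈ Icc α β := interior_subset hx
        rw [(hsq x hx').deriv]
        linarith [hgg' x hx']
  have hsq1 : ∀ x ∈ Icc α β, 1 ≤ g x * g x := fun x hx => by
    have h : g α * g α ≤ g x * g x := hmono2 (left_mem_Icc.2 (hx.1.trans hx.2)) hx hx.1
    rwa [hgα, mul_one] at h
  -- `g` is continuous with `g(α) = 1 > 0` and never vanishes, hence `g > 0`
  intro x hx
  by_contra hneg
  have hcont : ContinuousOn g (Icc α x) := fun y hy =>
    (hg y ⟨hy.1, hy.2.trans hx.2⟩).1.continuousAt.continuousWithinAt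
  obtain ⟨c, hc, hc0⟩ := intermediate_value_Icc' hx.1 hcont
    ⟨not_lt.1 hneg, by rw [hgα]; exact zero_le_one⟩
  have h := hsq1 c ⟨hc.1, hc.2.trans hx.2⟩
  rw [hc0, mul_zero] at h
  exact absurd h (not_le.2 one_pos)

/-! ## The upper bounds -/

/-- **Upper bounds for the left barrier function.** Let `g″ = q g` on `[α, β]` (pointwise
`HasDerivAt` form) with `g(α) = 1`, `g′(α) = 0`, and `0 ≤ q ≤ K²` there (`K ≥ 0`). Then for
`x ∈ [α, β]`: `g(x) ≤ cosh K(x − α)` and `g′(x) ≤ K sinh K(x − α)` (Sturm comparison with the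
solution `cosh K(x − α)` of the majorant equation `y″ = K² y` with the same data), and
`g(x) ≤ 1 + g′(β)(x − α)`, `g′(x) ≤ g′(β)` (since `g > 0` and `q ≥ 0` make `g′` non-decreasing:
positive solutions are convex, Hartman Ch. XI, proof of Cor. 6.4).
[cite: Hartman2002, Ch. XI Thm. 3.2 and Cor. 6.4] -/
theorem barrierBasis_upper {q g g' : ℝ → ℝ} {α β K : ℝ} (hαβ : α ≤ β) (hK : 0 ≤ K)
    (hg : ∀ x ∈ Icc α β, HasDerivAt g (g' x) x ∧ HasDerivAt g' (q x * g x) x)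
    (hgα : g α = 1) (hg'α : g' α = 0)
    (hq0 : ∀ x ∈ Icc α β, 0 ≤ q x) (hqK : ∀ x ∈ Icc α β, q x ≤ K ^ 2) {x : ℝ} (hx : x ∈ Icc α β) :
    g x ≤ Real.cosh (K * (x - α)) ∧ g' x ≤ K * Real.sinh (K * (x - α)) ∧
    g x ≤ 1 + g' β * (x - α) ∧ g' x ≤ g' β := by
  have hα : α ∈ Icc α β := left_mem_Icc.2 hαβ
  have hβ : β ∈ Icc α β := right_mem_Icc.2 hαβ
  have hpos := pos_of_left_data_of_nonneg_coeff hg hgα hg'α hq0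
  -- (i) comparison with the majorant `cosh K(x − α)`
  have hcmp := le_of_majorant_sol (C := fun s => Real.cosh (K * (s - α)))
    (C' := fun s => K * Real.sinh (K * (s - α))) (c := fun _ => K ^ 2) hg
    (fun s _ => ⟨hasDerivAt_cosh_mul_sub K α s, hasDerivAt_sinh_mul_sub K α s⟩)
    hqK (fun s hs => (hpos s hs).le) (fun s _ => Real.cosh_pos _)
    (fun s hs => mul_nonneg hK (Real.sinh_nonneg_iff.2 (mul_nonneg hK (sub_nonneg.2 hs.1))))
    (by simp [hgα]) (by simp [hgα, hg'α]) x hx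
  -- (ii) `g′` is non-decreasing (`g″ = q g ≥ 0`)
  have hmono : MonotoneOn g' (Icc α β) :=
    monotoneOn_of_deriv_nonneg (convex_Icc α β)
      (fun s hs => (hg s hs).2.continuousAt.continuousWithinAt)
      (fun s hs => (hg s (interior_subset hs)).2.differentiableAt.differentiableWithinAt)
      fun s hs => by
        have hs' : s ∈ Icc α β := interior_subset hs
        rw [(hg s hs').2.deriv]
        exact mul_nonneg (hq0 s hs') (hpos s hs').le
  -- the gap `1 + g′(β)(s − α) − g(s)` is non-decreasing and vanishes at `α`
  have hh : ∀ s ∈ Icc α β,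
      HasDerivAt (fun s => 1 + g' β * (s - α) - g s) (g' β * 1 - g' s) s := fun s hs =>
    ((((hasDerivAt_id' s).sub_const α).const_mul (g' β)).const_add 1).sub (hg s hs).1
  have hhmono : MonotoneOn (fun s => 1 + g' β * (s - α) - g s) (Icc α β) :=
    monotoneOn_of_deriv_nonneg (convex_Icc α β)
      (fun s hs => (hh s hs).continuousAt.continuousWithinAt)
      (fun s hs => (hh s (interior_subset hs)).differentiableAt.differentiableWithinAt)
      fun s hs => by
        have hs' : s ∈ Icc α β := interior_subset hs
        rw [(hh s hs').deriv]
        linarith [hmono hs' hβ hs'.2]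
  have h3 : 1 + g' β * (α - α) - g α ≤ 1 + g' β * (x - α) - g x := hhmono hα hx hx.1
  exact ⟨hcmp.1, hcmp.2, by linarith [hgα], hmono hx hβ hx.2⟩

/-- **Upper bounds for the right barrier function.** Let `d″ = q d` on `[α, β]` (pointwise
`HasDerivAt` form) with `d(β) = 1`, `d′(β) = 0`, and `0 ≤ q ≤ K²` there (`K ≥ 0`). Then for
`x ∈ [α, β]`: `d(x) ≤ cosh K(β − x)`, `−d′(x) ≤ K sinh K(β − x)`, `d(x) ≤ 1 + (−d′(α))(β − x)` and
`−d′(x) ≤ −d′(α)` (the left version `barrierBasis_upper` applied to the reflected solution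
`x ↦ d(α + β − x)` of `y″ = q(α + β − x) y`). [cite: Hartman2002, Ch. XI Thm. 3.2 and Cor. 6.4] -/
theorem barrierBasis_upper_right {q d d' : ℝ → ℝ} {α β K : ℝ} (hαβ : α ≤ β) (hK : 0 ≤ K)
    (hd : ∀ x ∈ Icc α β, HasDerivAt d (d' x) x ∧ HasDerivAt d' (q x * d x) x)
    (hdβ : d β = 1) (hd'β : d' β = 0)
    (hq0 : ∀ x ∈ Icc α β, 0 ≤ q x) (hqK : ∀ x ∈ Icc α β, q x ≤ K ^ 2) {x : ℝ} (hx : x ∈ Icc α β) :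
    d x ≤ Real.cosh (K * (β - x)) ∧ -d' x ≤ K * Real.sinh (K * (β - x)) ∧
    d x ≤ 1 + (-d' α) * (β - x) ∧ -d' x ≤ -d' α := by
  -- the reflection `y ↦ α + β − y` maps `[α, β]` onto itself
  have hrefl : ∀ y ∈ Icc α β, α + β - y ∈ Icc α β := fun y hy =>
    ⟨by linarith [hy.2], by linarith [hy.1]⟩
  -- `G y = d (α + β − y)`, `G′ y = −d′ (α + β − y)` solve `G″ = q (α + β − y) G`
  have hG : ∀ y ∈ Icc α β, HasDerivAt (fun y => d (α + β - y)) (-d' (α + β - y)) y ∧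
      HasDerivAt (fun y => -d' (α + β - y)) (q (α + β - y) * d (α + β - y)) y := fun y hy => by
    have ha : HasDerivAt (fun y : ℝ => α + β - y) (-1) y := (hasDerivAt_id' y).const_sub (α + β)
    exact ⟨((hd _ (hrefl y hy)).1.comp y ha).congr_deriv (by ring),
      ((hd _ (hrefl y hy)).2.comp y ha).neg.congr_deriv (by ring)⟩
  have h := barrierBasis_upper (g := fun y => d (α + β - y)) (g' := fun y => -d' (α + β - y))
    (q := fun y => q (α + β - y)) hαβ hK hG (by simp [hdβ]) (by simp [hd'β])
    (fun y hy => hq0 _ (hrefl y hy)) (fun y hy => hqK _ (hrefl y hy)) (hrefl x hx)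
  have hx' : α + β - (α + β - x) = x := sub_sub_cancel _ _
  have hβ' : α + β - β = α := add_sub_cancel_right _ _
  have hX : α + β - x - α = β - x := by ring
  simp only [hx', hβ', hX] at h
  exact h

end Literature.Analysis.ODE
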